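import Summits.NavierStokesRegularity.NavierStokesRegularity.Theses.FilamentSkeletonRss

/-!
# Route `FilamentSkeletonRss` · crux `TransverseReductionR` (stmt-NavierStokesRegularity-19175) — parameter census and the shape of a refutation

Refutation-first lane `ns-filament-19175-p1` (2026-08-27).  `TransverseReductionR` (route rev 9, the θ₀-tilt
repair of `TransverseReduction` stmt-18688) says: for all box constants `(N, δ, ρ, K, Λ, a, b, cnd, η, Rw, Rb,
cg, θ₀)` there is `Γ₁` such that for every `Γ ≥ Γ₁` EVERY tilted, parameter-bounded skeleton box (regularised
Biot–Savart relative equilibrium in the rotating Leray frame, unique supercritical stagnation point per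
filament, tilt `|⟪X′_j(c_j), e₃⟫| ≤ 1 − θ₀`, bounds `θ₀ ≤ |α|, |γ_j| ≤ θ₀⁻¹`) carries a continuous reduced
family `(U_p, P_p, B_p)` of Perelman's rotated Leray profile system modulo the `N` accretion modes.

What is kernel-checked here (negative-side bookkeeping; NOT a claim about NS regularity or blow-up):

* `transverseReductionR_iff_nondegenerate` — the SURVIVING REDUCED STATEMENT: the crux is equivalent to its
  restriction to the parameter region `cg ≤ 1 ∧ θ₀ ≤ 1 ∧ 0 ≤ K ∧ 3/2 + δ ≤ Λ ∧ 0 ≤ cnd ∧ (2 ≤ N → ρ ≤ 2 Rw)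
  ∧ (N = 1 → 0 < K)`; outside it the box hypotheses are contradictory at every `Γ ≥ 1` and the crux holds
  vacuously (lemmas `TransverseReductionRCensus.*`; the last one is the slip computation `w′ ≡ 1/2` on a
  straight filament, whose regularised self-induction vanishes on itself).
* `not_transverseReductionR_iff_boxWitness` — `¬ TransverseReductionR` is EQUIVALENT to: for some
  non-degenerate parameter tuple, at arbitrarily large `Γ`, the tilted box class is INHABITED by a box on
  which every candidate reduced family fails.  An unconditional `¬`-theorem therefore needs an explicit
  tilted supercritical relative equilibrium (the burden of the sibling crux `SelectionBoxR`, minus its sign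
  law); none exists in the tree, which is why the two crux-attack vettings (2026-08-17, 2026-08-27) and this
  lane end with SURVIVES rather than a `¬`-file.

Desk tests recorded on the item (evidence `TESTS-19175.md`), not formalised: (i) the far-field circulation
law that refuted stmt-18688 (test field `Φ₀ = e^{−z²/4} e_φ/r ∈ ker 𝓛_α*`) pairs FINITELY with a tilted
Gaussian-cut Lamb–Oseen accretion mode — the overlap of the slabs `|z| ≲ 1` and `|s| ≲ 1` is a tube around the
line `{s = 0, z = 0}` with Gaussian cross-section mass `2π/|sin ϑ|`, and the integrand there is `≍ cos ϑ / L²`,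
so `d_j ≍ cot ϑ_j` is finite and no accretion scalar is forced to vanish; (ii) the tree's profile Liouville
theorems (finite-energy Euler DSS strata, p517612; NRŠ/Tsai at `α = 0`) do not meet the conclusion class
(`|U| ≤ C₀/(1+|y|)` has infinite energy, `θ₀ ≤ |α|`, and the equation is forced); at `B = 0`, `α ≈ 1` the
question is Pineau–Vicol's Conjecture 1.1 itself (the route target).
-/

set_option linter.dupNamespace false

noncomputable section

namespace Summit.NavierStokesRegularity.NavierStokesRegularity.Theorems

open Set Function Filter MeasureTheory Real
open Literature.Analysis.FluidPDE
open Summit.NavierStokesRegularity.NavierStokesRegularity.Theses.FilamentSkeletonRss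
open scoped InnerProductSpace Topology

namespace TransverseReductionRCensus

/-- No-return clause + unit speed force `cg ≤ 1`: at parameter distance exactly `ρ√Γ` the chord is at
most `ρ√Γ` (the curve is `1`-Lipschitz) and at least `cg ρ√Γ`. [folklore] -/
theorem cg_le_one {ρ cg Γ : ℝ} (hρ : 0 < ρ) (hΓ : 0 < Γ) {X : ℝ → EuclideanSpace ℝ (Fin 3)}
    (hX : ContDiff ℝ 2 X) (hunit : ∀ τ, ‖deriv X τ‖ = 1)
    (hnoret : ∀ τ σ : ℝ, ρ * √Γ ≤ |τ - σ| → cg * ρ * √Γ ≤ ‖X τ - X σ‖) : cg ≤ 1 := by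
  have hd : Differentiable ℝ X := hX.differentiable (by norm_num)
  have hLip : LipschitzWith 1 X := by
    refine lipschitzWith_of_nnnorm_deriv_le hd fun τ => ?_
    rw [← NNReal.coe_le_coe, coe_nnnorm, hunit τ, NNReal.coe_one]
  have hs : 0 < ρ * √Γ := mul_pos hρ (Real.sqrt_pos.2 hΓ)
  have h1 := hnoret (ρ * √Γ) 0 (by rw [sub_zero, abs_of_pos hs])
  have h2 : ‖X (ρ * √Γ) - X 0‖ ≤ ρ * √Γ := by
    have := hLip.dist_le_mul (ρ * √Γ) 0
    rwa [NNReal.coe_one, one_mul, dist_eq_norm, Real.dist_eq, sub_zero, abs_of_pos hs] at this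
  have h3 : cg * (ρ * √Γ) ≤ 1 * (ρ * √Γ) := by rw [← mul_assoc, one_mul]; exact h1.trans h2
  exact le_of_mul_le_mul_right h3 hs

/-- The bounds `θ₀ ≤ |α| ≤ θ₀⁻¹` force `θ₀ ≤ 1`. [folklore] -/
theorem theta_le_one {θ₀ α : ℝ} (hθ₀ : 0 < θ₀) (h1 : θ₀ ≤ |α|) (h2 : |α| ≤ θ₀⁻¹) : θ₀ ≤ 1 := by
  have h : θ₀ * θ₀ ≤ θ₀⁻¹ * θ₀ := mul_le_mul_of_nonneg_right (h1.trans h2) hθ₀.le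
  rw [inv_mul_cancel₀ hθ₀.ne'] at h
  nlinarith

/-- The curvature clause `‖X″‖ √Γ ≤ K` forces `0 ≤ K`. [folklore] -/
theorem K_nonneg {K Γ : ℝ} {X : ℝ → EuclideanSpace ℝ (Fin 3)} (τ : ℝ)
    (h : ‖iteratedDeriv 2 X τ‖ * √Γ ≤ K) : 0 ≤ K :=
  le_trans (mul_nonneg (norm_nonneg _) (Real.sqrt_nonneg _)) h

/-- The normal-variation clause, tested on `Y = 0` with `L = 1`, forces `0 ≤ cnd`. [folklore] -/
theorem cnd_nonneg {N : ℕ} {a b cnd : ℝ} {X : Fin N → ℝ → EuclideanSpace ℝ (Fin 3)} {c : Fin N → ℝ}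
    {T : (Fin N → ℝ → EuclideanSpace ℝ (Fin 3)) → Fin N → ℝ → EuclideanSpace ℝ (Fin 3)} (j : Fin N)
    (h13 : ∀ Y : Fin N → ℝ → EuclideanSpace ℝ (Fin 3), (∀ j, ContDiff ℝ 2 (Y j)) →
      (∀ j τ, ⟪Y j τ, deriv (X j) τ⟫_ℝ = 0) →
      ∑ j, ⟪Y j (c j), cross (EuclideanSpace.single 2 1) (X j (c j))⟫_ℝ = 0 →
      (∀ j τ, ‖Y j τ‖ + ‖deriv (Y j) τ‖ + ‖iteratedDeriv 2 (Y j) τ‖ ≤ (1 + |τ - c j|) ^ b) →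
      ∀ L : ℝ, (∀ j τ, ‖deriv (fun s : ℝ => T (fun k σ => X k σ + s • Y k σ) j τ) 0‖ ≤
        L * (1 + |τ - c j|) ^ a) →
      ∀ j τ, ‖Y j τ‖ ≤ cnd * L * (1 + |τ - c j|) ^ b) : 0 ≤ cnd := by
  have h := h13 (fun _ _ => 0) (fun _ => contDiff_const) (fun _ _ => by simp) (by simp)
    (fun j τ => by
      simp only [norm_zero, deriv_const', iteratedDeriv_const, zero_add]
      split_ifs <;> simp only [norm_zero] <;> exact Real.rpow_nonneg (by positivity) _)
    1 (fun j τ => by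
      simp only [smul_zero, add_zero, deriv_const', norm_zero, one_mul]
      exact Real.rpow_nonneg (by positivity) _) j (c j)
  simpa using h

/-- Separation `ρ√Γ` between distinct filaments and waists inside `‖y‖ ≤ Rw√Γ` force `ρ ≤ 2 Rw`
once there are two filaments. [folklore] -/
theorem rho_le_two_Rw {N : ℕ} {ρ Rw Γ : ℝ} (hΓ : 0 < Γ) (hN : 2 ≤ N)
    {X : Fin N → ℝ → EuclideanSpace ℝ (Fin 3)} {c : Fin N → ℝ}
    (hsep : ∀ j k, j ≠ k → ∀ τ σ, ρ * √Γ ≤ ‖X j τ - X k σ‖) (hwaist : ∀ j, ‖X j (c j)‖ ≤ Rw * √Γ) :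
    ρ ≤ 2 * Rw := by
  have h0 : 0 < N := by omega
  have h1 : 1 < N := by omega
  have hne : (⟨0, h0⟩ : Fin N) ≠ ⟨1, h1⟩ := by simp [Fin.ext_iff]
  have h := hsep ⟨0, h0⟩ ⟨1, h1⟩ hne (c ⟨0, h0⟩) (c ⟨1, h1⟩)
  have h' := (norm_sub_le _ _).trans (add_le_add (hwaist ⟨0, h0⟩) (hwaist ⟨1, h1⟩))
  have hs : 0 < √Γ := Real.sqrt_pos.2 hΓ
  have h3 : ρ * √Γ ≤ 2 * Rw * √Γ := by linarith [h.trans h']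
  exact le_of_mul_le_mul_right h3 hs

/-- `⟪a × b, b⟫ = 0`. [folklore] -/
theorem inner_cross_self_right (a b : EuclideanSpace ℝ (Fin 3)) : ⟪cross a b, b⟫_ℝ = 0 := by
  simp [cross, crossProduct, PiLp.inner_apply, Fin.sum_univ_three]
  ring

/-- `a × (r • a) = 0`. [folklore] -/
theorem cross_smul_self (a : EuclideanSpace ℝ (Fin 3)) (r : ℝ) : cross a (r • a) = 0 := by
  rw [← crossCLM_apply, map_smul, crossCLM_apply]
  have : cross a a = 0 := by simp [cross]
  rw [this, smul_zero]

/-- A single STRAIGHT filament cannot carry a supercritical stagnation point: if `N = 1` and `K ≤ 0`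
then the filament is a straight line `P + (τ − c) t`, its regularised Biot–Savart self-induction
vanishes identically on the line (`t × (τ − σ) t = 0`), so the slip is `w(τ) = const + (τ − c)/2`
(`⟪t, t⟫ = 1`, `⟪e₃ × t, t⟫ = 0`) and `w′(c) = 1/2 < 3/2 + δ`. Hence `N = 1` forces `0 < K`. [folklore] -/
theorem K_pos_of_single {δ K Γ αp : ℝ} (hδ : 0 < δ) (hΓ : 0 < Γ)
    {X : Fin 1 → ℝ → EuclideanSpace ℝ (Fin 3)} {w : Fin 1 → ℝ → ℝ} {c : Fin 1 → ℝ}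
    {u : (Fin 1 → ℝ → EuclideanSpace ℝ (Fin 3)) → EuclideanSpace ℝ (Fin 3) → EuclideanSpace ℝ (Fin 3)}
    {v : EuclideanSpace ℝ (Fin 3) → EuclideanSpace ℝ (Fin 3)} (coef : Fin 1 → ℝ)
    (hu : ∀ Z y, u Z y = ∑ k, coef k • ∫ σ : ℝ, ((‖y - Z k σ‖ ^ 2 + 1) ^ (3/2:ℝ))⁻¹ •
      cross (deriv (Z k) σ) (y - Z k σ))
    (hv : ∀ y, v y = u X y + (1/2:ℝ) • y - αp • cross (EuclideanSpace.single 2 1) y)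
    (hX : ∀ j, ContDiff ℝ 2 (X j)) (hunit : ∀ j τ, ‖deriv (X j) τ‖ = 1)
    (hcurv : ∀ j τ, ‖iteratedDeriv 2 (X j) τ‖ * √Γ ≤ K)
    (hwdef : ∀ j τ, w j τ = ⟪v (X j τ), deriv (X j) τ⟫_ℝ)
    (hstag : ∀ j, 3/2 + δ ≤ deriv (w j) (c j)) : 0 < K := by
  by_contra hK
  have hK' : K ≤ 0 := not_lt.1 hK
  have hs : 0 < √Γ := Real.sqrt_pos.2 hΓ
  -- the curve `X 0` is a straight line
  have h2 : ∀ τ, deriv (deriv (X 0)) τ = 0 := fun τ => by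
    have h := (hcurv 0 τ).trans hK'
    rw [show iteratedDeriv 2 (X 0) = deriv (deriv (X 0)) from by
      rw [iteratedDeriv_eq_iterate]; rfl] at h
    have : ‖deriv (deriv (X 0)) τ‖ ≤ 0 := by
      by_contra hc
      exact absurd h (not_le.2 (mul_pos (not_le.1 hc) hs))
    exact norm_le_zero_iff.1 this
  have hderiv : ∀ τ, deriv (X 0) τ = deriv (X 0) (c 0) := by
    have hd : Differentiable ℝ (deriv (X 0)) := by
      have := (hX 0).differentiable_iteratedDeriv 1 (by norm_num)
      rwa [iteratedDeriv_one] at this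
    intro τ
    exact is_const_of_deriv_eq_zero hd h2 τ (c 0)
  have hdX : Differentiable ℝ (X 0) := (hX 0).differentiable (by norm_num)
  have hline : ∀ τ, X 0 τ = X 0 (c 0) + (τ - c 0) • deriv (X 0) (c 0) := by
    have hdg' : ∀ s, HasDerivAt (fun s => X 0 s - s • deriv (X 0) (c 0)) 0 s := fun s => by
      have h1 : HasDerivAt (X 0) (deriv (X 0) (c 0)) s := hderiv s ▸ (hdX s).hasDerivAt
      have h2 : HasDerivAt (fun s : ℝ => s • deriv (X 0) (c 0)) (deriv (X 0) (c 0)) s := by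
        simpa using (hasDerivAt_id s).smul_const (deriv (X 0) (c 0))
      simpa using h1.fun_sub h2
    have hdg : ∀ s, deriv (fun s => X 0 s - s • deriv (X 0) (c 0)) s = 0 := fun s => (hdg' s).deriv
    have hdiff : Differentiable ℝ (fun s => X 0 s - s • deriv (X 0) (c 0)) :=
      fun s => (hdg' s).differentiableAt
    intro τ
    have := is_const_of_deriv_eq_zero hdiff hdg τ (c 0)
    have h' : X 0 τ = X 0 (c 0) - c 0 • deriv (X 0) (c 0) + τ • deriv (X 0) (c 0) := by
      rw [← this]; abel
    rw [h', sub_smul]; abel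
  -- the self-induction vanishes on the line
  have hu0 : ∀ τ, u X (X 0 τ) = 0 := fun τ => by
    rw [hu, Fin.sum_univ_one]
    have : (fun σ : ℝ => ((‖X 0 τ - X 0 σ‖ ^ 2 + 1) ^ (3/2:ℝ))⁻¹ •
        cross (deriv (X 0) σ) (X 0 τ - X 0 σ)) = fun _ => 0 := by
      funext σ
      rw [hderiv σ, hline τ, hline σ]
      have : X 0 (c 0) + (τ - c 0) • deriv (X 0) (c 0) - (X 0 (c 0) + (σ - c 0) • deriv (X 0) (c 0))
          = (τ - σ) • deriv (X 0) (c 0) := by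
        rw [add_sub_add_left_eq_sub, ← sub_smul]; ring_nf
      rw [this, cross_smul_self, smul_zero]
    rw [this, integral_zero, smul_zero]
  -- the slip is affine with slope `1/2`
  have ht1 : ⟪deriv (X 0) (c 0), deriv (X 0) (c 0)⟫_ℝ = 1 := by
    rw [real_inner_self_eq_norm_sq, hunit 0 (c 0), one_pow]
  set t := deriv (X 0) (c 0) with ht
  set P := X 0 (c 0) with hP
  have hw : ∀ τ, w 0 τ = ((1/2:ℝ) * ⟪P, t⟫_ℝ - αp * ⟪cross (EuclideanSpace.single 2 1) P, t⟫_ℝ) +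
      (1/2:ℝ) * (τ - c 0) := fun τ => by
    rw [hwdef, hv, hu0, zero_add, hderiv τ, hline τ]
    have hc : cross (EuclideanSpace.single 2 1) (P + (τ - c 0) • t)
        = cross (EuclideanSpace.single 2 1) P + (τ - c 0) • cross (EuclideanSpace.single 2 1) t := by
      rw [← crossCLM_apply, map_add, map_smul]; rfl
    simp only [hc, inner_sub_left, inner_add_left, real_inner_smul_left, ht1, inner_cross_self_right]
    ring
  have hdw : deriv (w 0) (c 0) = 1/2 := by
    have hfun : w 0 = fun τ => ((1/2:ℝ) * ⟪P, t⟫_ℝ - αp * ⟪cross (EuclideanSpace.single 2 1) P, t⟫_ℝ) +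
        (1/2:ℝ) * (τ - c 0) := funext hw
    have hd : HasDerivAt (fun τ => ((1/2:ℝ) * ⟪P, t⟫_ℝ - αp * ⟪cross (EuclideanSpace.single 2 1) P, t⟫_ℝ) +
        (1/2:ℝ) * (τ - c 0)) ((1/2:ℝ) * 1) (c 0) :=
      (((hasDerivAt_id (c 0)).sub_const (c 0)).const_mul (1/2:ℝ)).const_add _
    rw [hfun, hd.deriv, mul_one]
  have := hstag 0
  rw [hdw] at this
  linarith

end TransverseReductionRCensus

open TransverseReductionRCensus in
/-- **Parameter census / the surviving reduced statement.** `TransverseReductionR` is equivalent to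
its restriction to the NON-DEGENERATE parameter region
`cg ≤ 1 ∧ θ₀ ≤ 1 ∧ 0 ≤ K ∧ 3/2 + δ ≤ Λ ∧ 0 ≤ cnd ∧ (2 ≤ N → ρ ≤ 2 Rw) ∧ (N = 1 → 0 < K)`:
outside it the tilted skeleton-box hypotheses are contradictory at every `Γ ≥ 1` (no-return vs. unit
speed; `θ₀ ≤ |α| ≤ θ₀⁻¹`; `‖X″‖√Γ ≤ K`; `3/2 + δ ≤ w′(c) ≤ Λ`; the normal-variation clause at `Y = 0`;
separation vs. waists; a single straight filament has `w′ ≡ 1/2`), so the crux holds there vacuously.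
A prover of the crux may assume the seven inequalities; a refuter must work inside them. [folklore] -/
theorem transverseReductionR_iff_nondegenerate :
    TransverseReductionR ↔
    (∀ (N:ℕ) (δ ρ K Λ a b cnd η Rw Rb cg θ₀:ℝ), 0 < N → 0 < δ → 0 < ρ → 0 < η → 0 < Rw → 0 < Rb → 0
      < cg → 0 < θ₀ → cg ≤ 1 → θ₀ ≤ 1 → 0 ≤ K → 3/2+δ ≤ Λ → 0 ≤ cnd → (2 ≤ N → ρ ≤ 2*Rw) → (N = 1 →
      0 < K) → ∃ Γ₁:ℝ, ∀ Γ:ℝ, Γ₁≤Γ → ∀ (γ:(Fin N → ℝ) → Fin N → ℝ) (α:(Fin N → ℝ) → ℝ) (X:(Fin N →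
      ℝ) → Fin N → ℝ → EuclideanSpace ℝ (Fin 3)) (w:(Fin N → ℝ) → Fin N → ℝ → ℝ) (c:(Fin N → ℝ) →
      Fin N → ℝ) (m n:(Fin N → ℝ) → Fin N → EuclideanSpace ℝ (Fin 3)) (u:(Fin N → ℝ)→(Fin N → ℝ →
      EuclideanSpace ℝ (Fin 3)) → EuclideanSpace ℝ (Fin 3) → EuclideanSpace ℝ (Fin 3)) (v:(Fin N →
      ℝ) → EuclideanSpace ℝ (Fin 3) → EuclideanSpace ℝ (Fin 3)) (A:(Fin N → ℝ) → Fin N →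
      (EuclideanSpace ℝ (Fin 3) →L[ℝ] EuclideanSpace ℝ (Fin 3))) (T:(Fin N → ℝ)→(Fin N → ℝ →
      EuclideanSpace ℝ (Fin 3)) → Fin N → ℝ → EuclideanSpace ℝ (Fin 3)) (D:(Fin N → ℝ) → Fin N →
      EuclideanSpace ℝ (Fin 3) → EuclideanSpace ℝ (Fin 3)), (∀ p Z y, u p Z y = ∑ k, (Γ*γ p
      k/(4*Real.pi)) • ∫ σ:ℝ, ((‖y-Z k σ‖^2+1)^(3/2:ℝ))⁻¹ • cross (deriv (Z k) σ) (y-Z k σ))→(∀ p y,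
      v p y = u p (X p) y+(1/2:ℝ) • y-α p • cross (EuclideanSpace.single 2 1) y)→(∀ p j, A p j =
      fderiv ℝ (v p) (X p j (c p j)))→(∀ p Z j τ, T p Z j τ = (u p Z (Z j τ)+(1/2:ℝ) • Z j τ-α p •
      cross (EuclideanSpace.single 2 1) (Z j τ))-(⟪u p Z (Z j τ)+(1/2:ℝ) • Z j τ-α p • cross
      (EuclideanSpace.single 2 1) (Z j τ), deriv (Z j) τ⟫_ℝ/‖deriv (Z j) τ‖^2) • deriv (Z j) τ)→(∀ p
      j y, D p j y = (Real.exp (-(⟪y-X p j (c p j), deriv (X p j) (c p j)⟫_ℝ)^2)*((1-Real.exp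
      (-(‖y-X p j (c p j)‖^2-⟪y-X p j (c p j), deriv (X p j) (c p j)⟫_ℝ^2)))/(‖y-X p j (c p
      j)‖^2-⟪y-X p j (c p j), deriv (X p j) (c p j)⟫_ℝ^2))) • cross (deriv (X p j) (c p j)) (y-X p j
      (c p j)))→((∀ j, ContinuousOn (fun q:(Fin N → ℝ) × ℝ => (α q.1, γ q.1 j, X q.1 j q.2, w q.1 j
      q.2)) ({p:Fin N → ℝ | ∀ i, p i ∈ Icc 0 1} ×ˢ univ))∧(∀ p:Fin N → ℝ, (∀ i, p i ∈ Icc 0 1) → α p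
      ≠ 0 ∧ (∀ j, γ p j ≠ 0)∧(∀ j, ContDiff ℝ 2 (X p j) ∧ Differentiable ℝ (w p j)∧(∀ τ, ‖deriv (X p
      j) τ‖ = 1)∧(∀ τ, ‖iteratedDeriv 2 (X p j) τ‖*√Γ≤K) ∧ Tendsto (fun τ => ‖X p j τ‖) (cocompact
      ℝ) atTop)∧(∀ j k, j ≠ k → ∀ τ σ, ρ*√Γ≤‖X p j τ-X p k σ‖)∧(∀ j τ σ, ρ*√Γ≤|τ-σ| → cg*ρ*√Γ≤‖X p j
      τ-X p j σ‖)∧(∀ j τ, cg*|τ-c p j|≤Rw*√Γ+‖X p j τ‖)∧(∀ j τ, w p j τ = ⟪v p (X p j τ), deriv (X p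
      j) τ⟫_ℝ)∧(∀ j τ, ‖X p j τ‖≤Rb*√(Γ*Real.log Γ) → v p (X p j τ) = w p j τ • deriv (X p j) τ)∧(∀
      j, ‖X p j (c p j)‖≤Rw*√Γ)∧(∀ j, |⟪deriv (X p j) (c p j), EuclideanSpace.single 2
      1⟫_ℝ|≤1-θ₀)∧(θ₀≤|α p| ∧ |α p|≤θ₀⁻¹ ∧ ∀ j, θ₀≤|γ p j| ∧ |γ p j|≤θ₀⁻¹)∧(∀ j, w p j (c p j) = 0 ∧
      (∀ τ, w p j τ = 0 → τ = c p j) ∧ 3/2+δ≤deriv (w p j) (c p j) ∧ deriv (w p j) (c p j)≤Λ)∧(∀ j,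
      Orthonormal ℝ ![deriv (X p j) (c p j), m p j, n p j] ∧ ⟪A p j (m p j), m p j⟫_ℝ+⟪A p j (n p
      j), n p j⟫_ℝ < 0 ∧ ⟪A p j (n p j), m p j⟫_ℝ * ⟪A p j (m p j), n p j⟫_ℝ < ⟪A p j (m p j), m p
      j⟫_ℝ * ⟪A p j (n p j), n p j⟫_ℝ)∧(∀ Y:Fin N → ℝ → EuclideanSpace ℝ (Fin 3), (∀ j, ContDiff ℝ 2
      (Y j))→(∀ j τ, ⟪Y j τ, deriv (X p j) τ⟫_ℝ = 0) → ∑ j, ⟪Y j (c p j), cross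
      (EuclideanSpace.single 2 1) (X p j (c p j))⟫_ℝ = 0 → (∀ j τ, ‖Y j τ‖+‖deriv (Y j)
      τ‖+‖iteratedDeriv 2 (Y j) τ‖≤(1+|τ-c p j|)^b) → ∀ L:ℝ, (∀ j τ, ‖deriv (fun s:ℝ => T p (fun k σ
      => X p k σ+s • Y k σ) j τ) 0‖≤L*(1+|τ-c p j|)^a) → ∀ j τ, ‖Y j τ‖≤cnd*L*(1+|τ-c p j|)^b))) → ∃
      (C₀ M:ℝ) (U:(Fin N → ℝ) → EuclideanSpace ℝ (Fin 3) → EuclideanSpace ℝ (Fin 3)) (P:(Fin N → ℝ)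
      → EuclideanSpace ℝ (Fin 3) → ℝ) (B:(Fin N → ℝ) → Fin N → ℝ), (ContinuousOn B {p:Fin N → ℝ | ∀
      i, p i ∈ Icc 0 1} ∧ ∀ p:Fin N → ℝ, (∀ i, p i ∈ Icc 0 1) → U p ≠ 0 ∧ ContDiff ℝ (⊤:ℕ∞) (U p) ∧
      ContDiff ℝ (⊤:ℕ∞) (P p) ∧ VectorCalculus.IsDivFree (U p)∧(∀ y, α p • (cross
      (EuclideanSpace.single 2 1) (U p y)-fderiv ℝ (U p) y (cross (EuclideanSpace.single 2 1)
      y))+(1/2:ℝ) • U p y+(1/2:ℝ) • fderiv ℝ (U p) y y-(Laplacian.laplacian (U p)) y+fderiv ℝ (U p)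
      y (U p y)+gradient (P p) y = ∑ j, B p j • D p j y)∧(∀ y, ‖U p y‖≤C₀/(1+‖y‖))∧(∀ y, |P p
      y|≤M)∧(∀ y, ‖y‖≤Rw*√Γ → (∀ j τ, ρ*√Γ/4≤‖y-X p j τ‖) → ‖U p y-u p (X p) y‖≤η*√Γ))) := by
  unfold TransverseReductionR
  constructor
  · intro h N δ ρ K Λ a b cnd η Rw Rb cg θ₀ hN hδ hρ hη hRw hRb hcg hθ₀ _ _ _ _ _ _ _
    exact h N δ ρ K Λ a b cnd η Rw Rb cg θ₀ hN hδ hρ hη hRw hRb hcg hθ₀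
  · intro h N δ ρ K Λ a b cnd η Rw Rb cg θ₀ hN hδ hρ hη hRw hRb hcg hθ₀
    by_cases hnd : cg ≤ 1 ∧ θ₀ ≤ 1 ∧ 0 ≤ K ∧ 3/2+δ ≤ Λ ∧ 0 ≤ cnd ∧ (2 ≤ N → ρ ≤ 2*Rw) ∧
        (N = 1 → 0 < K)
    · obtain ⟨h1, h2, h3, h4, h5, h6, h7⟩ := hnd
      exact h N δ ρ K Λ a b cnd η Rw Rb cg θ₀ hN hδ hρ hη hRw hRb hcg hθ₀ h1 h2 h3 h4 h5 h6 h7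
    · refine ⟨1, fun Γ hΓ γ α X w c _ _ u v _ T _ hu hv _ _ _ hbox => ?_⟩
      exfalso
      apply hnd
      have hΓ0 : 0 < Γ := by linarith
      have hp₀ : ∀ i : Fin N, (fun _ => (0:ℝ)) i ∈ Icc (0:ℝ) 1 := fun _ => ⟨le_rfl, zero_le_one⟩
      obtain ⟨-, -, hreg, hsep, hnoret, -, hwdef, -, hwaist, -, hbds, hstag, -, h13⟩ :=
        hbox.2 (fun _ => (0:ℝ)) hp₀
      refine ⟨?_, ?_, ?_, ?_, ?_, ?_, ?_⟩
      · exact cg_le_one hρ hΓ0 (hreg ⟨0, hN⟩).1 (hreg ⟨0, hN⟩).2.2.1 (hnoret ⟨0, hN⟩)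
      · exact theta_le_one hθ₀ hbds.1 hbds.2.1
      · exact K_nonneg (c (fun _ => (0:ℝ)) ⟨0, hN⟩) ((hreg ⟨0, hN⟩).2.2.2.1 _)
      · exact (hstag ⟨0, hN⟩).2.2.1.trans (hstag ⟨0, hN⟩).2.2.2
      · exact cnd_nonneg ⟨0, hN⟩ h13
      · exact fun hN2 => rho_le_two_Rw hΓ0 hN2 hsep hwaist
      · intro hN1
        subst hN1
        exact K_pos_of_single hδ hΓ0 (fun k => Γ * γ (fun _ => (0:ℝ)) k / (4 * Real.pi))
          (hu (fun _ => (0:ℝ))) (hv (fun _ => (0:ℝ))) (fun j => (hreg j).1)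
          (fun j => (hreg j).2.2.1) (fun j => (hreg j).2.2.2.1) hwdef (fun j => (hstag j).2.2.1)

/-- **What a refutation must exhibit.** `¬ TransverseReductionR` holds if and only if, for some
NON-DEGENERATE parameter tuple, at arbitrarily large circulation `Γ` the tilted, parameter-bounded
skeleton-box class is INHABITED by a box on which every candidate reduced family `(C₀, M, U, P, B)`
fails.  In particular an unconditional `¬`-theorem needs an explicit relative equilibrium of the
regularised Biot–Savart law with supercritical tilted stagnation cores (the burden of the sibling crux
`SelectionBoxR`, minus its sign law) — the formal content of the crux-attack verdict
«no inhabitant ⇒ no unconditional ¬S» (refuter notes on stmt-19175, 2026-08-17/27). [folklore] -/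
theorem not_transverseReductionR_iff_boxWitness :
    ¬ TransverseReductionR ↔
    (∃ (N:ℕ) (δ ρ K Λ a b cnd η Rw Rb cg θ₀:ℝ), (0 < N ∧ 0 < δ ∧ 0 < ρ ∧ 0 < η ∧ 0 < Rw ∧ 0 < Rb ∧
      0 < cg ∧ 0 < θ₀) ∧ (cg ≤ 1 ∧ θ₀ ≤ 1 ∧ 0 ≤ K ∧ 3/2+δ ≤ Λ ∧ 0 ≤ cnd ∧ (2 ≤ N → ρ ≤ 2*Rw) ∧ (N =
      1 → 0 < K)) ∧ ∀ Γ₁:ℝ, ∃ Γ:ℝ, Γ₁≤Γ ∧ ∃ (γ:(Fin N → ℝ) → Fin N → ℝ) (α:(Fin N → ℝ) → ℝ) (X:(Fin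
      N → ℝ) → Fin N → ℝ → EuclideanSpace ℝ (Fin 3)) (w:(Fin N → ℝ) → Fin N → ℝ → ℝ) (c:(Fin N → ℝ)
      → Fin N → ℝ) (m n:(Fin N → ℝ) → Fin N → EuclideanSpace ℝ (Fin 3)) (u:(Fin N → ℝ)→(Fin N → ℝ →
      EuclideanSpace ℝ (Fin 3)) → EuclideanSpace ℝ (Fin 3) → EuclideanSpace ℝ (Fin 3)) (v:(Fin N →
      ℝ) → EuclideanSpace ℝ (Fin 3) → EuclideanSpace ℝ (Fin 3)) (A:(Fin N → ℝ) → Fin N →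
      (EuclideanSpace ℝ (Fin 3) →L[ℝ] EuclideanSpace ℝ (Fin 3))) (T:(Fin N → ℝ)→(Fin N → ℝ →
      EuclideanSpace ℝ (Fin 3)) → Fin N → ℝ → EuclideanSpace ℝ (Fin 3)) (D:(Fin N → ℝ) → Fin N →
      EuclideanSpace ℝ (Fin 3) → EuclideanSpace ℝ (Fin 3)), (∀ p Z y, u p Z y = ∑ k, (Γ*γ p
      k/(4*Real.pi)) • ∫ σ:ℝ, ((‖y-Z k σ‖^2+1)^(3/2:ℝ))⁻¹ • cross (deriv (Z k) σ) (y-Z k σ)) ∧ (∀ p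
      y, v p y = u p (X p) y+(1/2:ℝ) • y-α p • cross (EuclideanSpace.single 2 1) y) ∧ (∀ p j, A p j
      = fderiv ℝ (v p) (X p j (c p j))) ∧ (∀ p Z j τ, T p Z j τ = (u p Z (Z j τ)+(1/2:ℝ) • Z j τ-α p
      • cross (EuclideanSpace.single 2 1) (Z j τ))-(⟪u p Z (Z j τ)+(1/2:ℝ) • Z j τ-α p • cross
      (EuclideanSpace.single 2 1) (Z j τ), deriv (Z j) τ⟫_ℝ/‖deriv (Z j) τ‖^2) • deriv (Z j) τ) ∧ (∀
      p j y, D p j y = (Real.exp (-(⟪y-X p j (c p j), deriv (X p j) (c p j)⟫_ℝ)^2)*((1-Real.exp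
      (-(‖y-X p j (c p j)‖^2-⟪y-X p j (c p j), deriv (X p j) (c p j)⟫_ℝ^2)))/(‖y-X p j (c p
      j)‖^2-⟪y-X p j (c p j), deriv (X p j) (c p j)⟫_ℝ^2))) • cross (deriv (X p j) (c p j)) (y-X p j
      (c p j))) ∧ ((∀ j, ContinuousOn (fun q:(Fin N → ℝ) × ℝ => (α q.1, γ q.1 j, X q.1 j q.2, w q.1
      j q.2)) ({p:Fin N → ℝ | ∀ i, p i ∈ Icc 0 1} ×ˢ univ))∧(∀ p:Fin N → ℝ, (∀ i, p i ∈ Icc 0 1) → α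
      p ≠ 0 ∧ (∀ j, γ p j ≠ 0)∧(∀ j, ContDiff ℝ 2 (X p j) ∧ Differentiable ℝ (w p j)∧(∀ τ, ‖deriv (X
      p j) τ‖ = 1)∧(∀ τ, ‖iteratedDeriv 2 (X p j) τ‖*√Γ≤K) ∧ Tendsto (fun τ => ‖X p j τ‖) (cocompact
      ℝ) atTop)∧(∀ j k, j ≠ k → ∀ τ σ, ρ*√Γ≤‖X p j τ-X p k σ‖)∧(∀ j τ σ, ρ*√Γ≤|τ-σ| → cg*ρ*√Γ≤‖X p j
      τ-X p j σ‖)∧(∀ j τ, cg*|τ-c p j|≤Rw*√Γ+‖X p j τ‖)∧(∀ j τ, w p j τ = ⟪v p (X p j τ), deriv (X p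
      j) τ⟫_ℝ)∧(∀ j τ, ‖X p j τ‖≤Rb*√(Γ*Real.log Γ) → v p (X p j τ) = w p j τ • deriv (X p j) τ)∧(∀
      j, ‖X p j (c p j)‖≤Rw*√Γ)∧(∀ j, |⟪deriv (X p j) (c p j), EuclideanSpace.single 2
      1⟫_ℝ|≤1-θ₀)∧(θ₀≤|α p| ∧ |α p|≤θ₀⁻¹ ∧ ∀ j, θ₀≤|γ p j| ∧ |γ p j|≤θ₀⁻¹)∧(∀ j, w p j (c p j) = 0 ∧
      (∀ τ, w p j τ = 0 → τ = c p j) ∧ 3/2+δ≤deriv (w p j) (c p j) ∧ deriv (w p j) (c p j)≤Λ)∧(∀ j,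
      Orthonormal ℝ ![deriv (X p j) (c p j), m p j, n p j] ∧ ⟪A p j (m p j), m p j⟫_ℝ+⟪A p j (n p
      j), n p j⟫_ℝ < 0 ∧ ⟪A p j (n p j), m p j⟫_ℝ * ⟪A p j (m p j), n p j⟫_ℝ < ⟪A p j (m p j), m p
      j⟫_ℝ * ⟪A p j (n p j), n p j⟫_ℝ)∧(∀ Y:Fin N → ℝ → EuclideanSpace ℝ (Fin 3), (∀ j, ContDiff ℝ 2
      (Y j))→(∀ j τ, ⟪Y j τ, deriv (X p j) τ⟫_ℝ = 0) → ∑ j, ⟪Y j (c p j), cross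
      (EuclideanSpace.single 2 1) (X p j (c p j))⟫_ℝ = 0 → (∀ j τ, ‖Y j τ‖+‖deriv (Y j)
      τ‖+‖iteratedDeriv 2 (Y j) τ‖≤(1+|τ-c p j|)^b) → ∀ L:ℝ, (∀ j τ, ‖deriv (fun s:ℝ => T p (fun k σ
      => X p k σ+s • Y k σ) j τ) 0‖≤L*(1+|τ-c p j|)^a) → ∀ j τ, ‖Y j τ‖≤cnd*L*(1+|τ-c p j|)^b))) ∧ ∀
      (C₀ M:ℝ) (U:(Fin N → ℝ) → EuclideanSpace ℝ (Fin 3) → EuclideanSpace ℝ (Fin 3)) (P:(Fin N → ℝ)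
      → EuclideanSpace ℝ (Fin 3) → ℝ) (B:(Fin N → ℝ) → Fin N → ℝ), ¬ (ContinuousOn B {p:Fin N → ℝ |
      ∀ i, p i ∈ Icc 0 1} ∧ ∀ p:Fin N → ℝ, (∀ i, p i ∈ Icc 0 1) → U p ≠ 0 ∧ ContDiff ℝ (⊤:ℕ∞) (U p)
      ∧ ContDiff ℝ (⊤:ℕ∞) (P p) ∧ VectorCalculus.IsDivFree (U p)∧(∀ y, α p • (cross
      (EuclideanSpace.single 2 1) (U p y)-fderiv ℝ (U p) y (cross (EuclideanSpace.single 2 1)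
      y))+(1/2:ℝ) • U p y+(1/2:ℝ) • fderiv ℝ (U p) y y-(Laplacian.laplacian (U p)) y+fderiv ℝ (U p)
      y (U p y)+gradient (P p) y = ∑ j, B p j • D p j y)∧(∀ y, ‖U p y‖≤C₀/(1+‖y‖))∧(∀ y, |P p
      y|≤M)∧(∀ y, ‖y‖≤Rw*√Γ → (∀ j τ, ρ*√Γ/4≤‖y-X p j τ‖) → ‖U p y-u p (X p) y‖≤η*√Γ))) := by
  rw [transverseReductionR_iff_nondegenerate]
  constructor
  · intro h
    by_contra hc
    apply h
    intro N δ ρ K Λ a b cnd η Rw Rb cg θ₀ hN hδ hρ hη hRw hRb hcg hθ₀ h1 h2 h3 h4 h5 h6 h7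
    by_contra hΓ
    apply hc
    refine ⟨N, δ, ρ, K, Λ, a, b, cnd, η, Rw, Rb, cg, θ₀, ⟨hN, hδ, hρ, hη, hRw, hRb, hcg, hθ₀⟩,
      ⟨h1, h2, h3, h4, h5, h6, h7⟩, fun Γ₁ => ?_⟩
    by_contra hΓ'
    apply hΓ
    refine ⟨Γ₁, fun Γ hle γ α X w c m n u v A T D hu hv hA hT hD hbox => ?_⟩
    by_contra hconc
    apply hΓ'
    exact ⟨Γ, hle, γ, α, X, w, c, m, n, u, v, A, T, D, hu, hv, hA, hT, hD, hbox,
      fun C₀ M U P B hc' => hconc ⟨C₀, M, U, P, B, hc'⟩⟩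
  · rintro ⟨N, δ, ρ, K, Λ, a, b, cnd, η, Rw, Rb, cg, θ₀, ⟨hN, hδ, hρ, hη, hRw, hRb, hcg, hθ₀⟩,
      ⟨h1, h2, h3, h4, h5, h6, h7⟩, hw⟩ h
    obtain ⟨Γ₁, hΓ₁⟩ := h N δ ρ K Λ a b cnd η Rw Rb cg θ₀ hN hδ hρ hη hRw hRb hcg hθ₀ h1 h2 h3 h4 h5 h6 h7
    obtain ⟨Γ, hle, γ, α, X, w, c, m, n, u, v, A, T, D, hu, hv, hA, hT, hD, hbox, hno⟩ := hw Γ₁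
    obtain ⟨C₀, M, U, P, B, hc⟩ := hΓ₁ Γ hle γ α X w c m n u v A T D hu hv hA hT hD hbox
    exact hno C₀ M U P B hc

end Summit.NavierStokesRegularity.NavierStokesRegularity.Theorems
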